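import Mathlib.Analysis.Polynomial.MahlerMeasure
import Mathlib.MeasureTheory.Integral.Bochner.Basic
import Mathlib.MeasureTheory.Integral.Lebesgue.Markov
import Literature.NumberTheory.Transcendental.RoySmallValueSupProd

/-!
# Route `PauliWegnerSea`, item `SingleLinkLogFlatness` (stmt-QuantumFields-11516) — one circle

Scalar ingredients of the proof of `SingleLinkLogFlatness` (the geometric-mean / Mahler-measure form
of single-link flatness of the Wilson sea):

* the truncated logarithm `t ↦ log (max t e^{-N})` (`≥ -N`, `≥ log t` for `t > 0`,
  `≤ max (log t) (-N)`, monotone, continuous);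
* `circle_step`: for `q ∈ ℂ[X]` with `deg q ≤ n` and every `θ₀`,
  `log (max ‖q(e^{iθ₀})‖ e^{-N}) - n log 2 ≤ (2π)⁻¹ ∫₀^{2π} log (max ‖q(e^{iθ})‖ e^{-N}) dθ` — the
  one-variable Mahler-measure bound `‖q(z)‖ ≤ 2^{deg q} M(q)` (`|z| ≤ 1`, Literature
  `Roy2013.norm_eval_le_two_pow_mul_mahlerMeasure`, from Mathlib's
  `Polynomial.norm_coeff_le_choose_mul_mahlerMeasure`) in a form immune to the junk value `log 0 = 0`;
* `le_integral_of_le_integral_max`: monotone convergence — if `f ≤ A` is measurable on a probability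
  space and `L ≤ ∫ max f (-N)` for all `N`, then `L ≤ ∫ f`.

All statements are [folklore]; no definitions (the truncated logarithm is written inline).
-/

noncomputable section

namespace Summit.QuantumFields.QCD.Theorems.SingleLinkLogFlatness

open MeasureTheory Real Polynomial Complex Set Filter

/-! ### The truncated logarithm `t ↦ log (max t e^{-N})` -/

/-- `-N ≤ log (max t e^{-N})`. [folklore] -/
theorem neg_le_logTrunc (N t : ℝ) : -N ≤ Real.log (max t (Real.exp (-N))) := by
  calc -N = Real.log (Real.exp (-N)) := (Real.log_exp _).symm
    _ ≤ _ := Real.log_le_log (Real.exp_pos _) (le_max_right _ _)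

/-- `log t ≤ log (max t e^{-N})` for `t > 0`. [folklore] -/
theorem log_le_logTrunc (N : ℝ) {t : ℝ} (ht : 0 < t) :
    Real.log t ≤ Real.log (max t (Real.exp (-N))) :=
  Real.log_le_log ht (le_max_left _ _)

/-- `log (max t e^{-N}) ≤ max (log t) (-N)`. [folklore] -/
theorem logTrunc_le_max (N t : ℝ) : Real.log (max t (Real.exp (-N))) ≤ max (Real.log t) (-N) := by
  rcases le_total t (Real.exp (-N)) with h | h
  · rw [max_eq_right h, Real.log_exp]; exact le_max_right _ _
  · rw [max_eq_left h]; exact le_max_left _ _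

/-- Monotonicity of the truncated logarithm in `t`. [folklore] -/
theorem logTrunc_mono (N : ℝ) {t B : ℝ} (h : t ≤ B) :
    Real.log (max t (Real.exp (-N))) ≤ Real.log (max B (Real.exp (-N))) :=
  Real.log_le_log (lt_max_of_lt_right (Real.exp_pos _)) (max_le_max h le_rfl)

/-- The truncated logarithm is continuous. [folklore] -/
theorem continuous_logTrunc (N : ℝ) : Continuous fun t : ℝ => Real.log (max t (Real.exp (-N))) :=
  (continuous_id.max continuous_const).log fun _ => (lt_max_of_lt_right (Real.exp_pos _)).ne'

/-! ### One circle: the Mahler-measure step -/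

/-- The set of real `θ` with `e^{iθ} = w` is countable. [folklore] -/
theorem countable_setOf_exp_eq (w : ℂ) : {θ : ℝ | cexp (θ * I) = w}.Countable := by
  by_cases hw : ∃ θ₁ : ℝ, cexp (θ₁ * I) = w
  · obtain ⟨θ₁, hθ₁⟩ := hw
    refine (Set.countable_range fun n : ℤ => θ₁ + n * (2 * π)).mono fun θ hθ => ?_
    rw [Set.mem_setOf_eq, ← hθ₁] at hθ
    obtain ⟨n, hn⟩ := Complex.exp_eq_exp_iff_exists_int.1 hθ
    refine ⟨n, ?_⟩
    have h1 : (θ : ℂ) = θ₁ + n * (2 * π) :=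
      mul_right_cancel₀ I_ne_zero (by rw [hn]; ring)
    have h2 : θ = θ₁ + n * (2 * π) := by exact_mod_cast h1
    rw [h2]
  · convert Set.countable_empty
    ext θ
    simp only [Set.mem_setOf_eq, Set.mem_empty_iff_false, iff_false]
    exact fun h => hw ⟨θ, h⟩

/-- For a non-zero polynomial `q`, the set of `θ` with `q(e^{iθ}) = 0` is countable. [folklore] -/
theorem countable_setOf_eval_exp_eq_zero {q : ℂ[X]} (hq : q ≠ 0) :
    {θ : ℝ | q.eval (cexp (θ * I)) = 0}.Countable := by
  refine ((q.finite_setOf_isRoot hq).countable.biUnion fun w _ => countable_setOf_exp_eq w).mono ?_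
  intro θ hθ
  simp only [Set.mem_iUnion, Set.mem_setOf_eq, exists_prop]
  exact ⟨cexp (θ * I), hθ, rfl⟩

/-- **One-circle Mahler step (truncated).** For `q ∈ ℂ[X]` with `deg q ≤ n` and every `θ₀`,
`log (max ‖q(e^{iθ₀})‖ e^{-N}) - n log 2 ≤ (2π)⁻¹ ∫₀^{2π} log (max ‖q(e^{iθ})‖ e^{-N}) dθ`:
if `q(e^{iθ₀}) = 0` the left side is `-N - n log 2`; otherwise `‖q(e^{iθ₀})‖ ≤ 2^{deg q} M(q)`
(coefficient bound via the Mahler measure) and `log M(q) = (2π)⁻¹ ∫ log ‖q(e^{iθ})‖` is dominated by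
the truncated integral (the integrands agree off the countable zero set up to `≤`). [folklore] -/
theorem circle_step (N : ℝ) {n : ℕ} (q : ℂ[X]) (hq : q.natDegree ≤ n) (θ₀ : ℝ) :
    Real.log (max ‖q.eval (cexp (θ₀ * I))‖ (Real.exp (-N))) - n * Real.log 2 ≤
      (2 * π)⁻¹ * ∫ θ in (0)..(2 * π), Real.log (max ‖q.eval (cexp (θ * I))‖ (Real.exp (-N))) := by
  have h2π : (0 : ℝ) ≤ 2 * π := by positivity
  have h2π' : (0 : ℝ) < 2 * π := by positivity
  have hlog2 : 0 ≤ (n : ℝ) * Real.log 2 := by positivity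
  have hcont : Continuous fun θ : ℝ => Real.log (max ‖q.eval (cexp (θ * I))‖ (Real.exp (-N))) :=
    (continuous_logTrunc N).comp (continuous_norm.comp (q.continuous.comp (by fun_prop)))
  -- the average is at least `-N`
  set avg : ℝ := (2 * π)⁻¹ * ∫ θ in (0)..(2 * π), Real.log (max ‖q.eval (cexp (θ * I))‖ (Real.exp (-N)))
    with havg
  have havgN : -N ≤ avg := by
    have h1 : ∫ θ in (0)..(2 * π), (-N : ℝ) ≤
        ∫ θ in (0)..(2 * π), Real.log (max ‖q.eval (cexp (θ * I))‖ (Real.exp (-N))) :=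
      intervalIntegral.integral_mono_on h2π intervalIntegrable_const (hcont.intervalIntegrable _ _)
        fun θ _ => neg_le_logTrunc N _
    rw [intervalIntegral.integral_const, sub_zero, smul_eq_mul] at h1
    calc -N = (2 * π)⁻¹ * (2 * π * -N) := by field_simp
      _ ≤ avg := by rw [havg]; exact mul_le_mul_of_nonneg_left h1 (inv_nonneg.2 h2π)
  by_cases h0 : q.eval (cexp (θ₀ * I)) = 0
  · rw [h0, norm_zero, max_eq_right (Real.exp_pos _).le, Real.log_exp]
    linarith
  have hq0 : q ≠ 0 := by rintro rfl; exact h0 (eval_zero)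
  -- the genuine Mahler integral is dominated by the truncated one
  have hdom : (2 * π)⁻¹ * ∫ θ in (0)..(2 * π), Real.log ‖q.eval (circleMap 0 1 θ)‖ ≤ avg := by
    rw [havg]
    refine mul_le_mul_of_nonneg_left ?_ (inv_nonneg.2 h2π)
    refine intervalIntegral.integral_mono_ae_restrict h2π q.intervalIntegrable_mahlerMeasure
      (hcont.intervalIntegrable _ _) ?_
    have hnull : volume.restrict (Icc 0 (2 * π)) {θ : ℝ | q.eval (cexp (θ * I)) = 0} = 0 :=
      (countable_setOf_eval_exp_eq_zero hq0).measure_zero _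
    have hae : ∀ᵐ θ ∂volume.restrict (Icc 0 (2 * π)), θ ∉ {θ : ℝ | q.eval (cexp (θ * I)) = 0} :=
      measure_eq_zero_iff_ae_notMem.1 hnull
    filter_upwards [hae] with θ hθ
    have hcm : circleMap 0 1 θ = cexp (θ * I) := by simp [circleMap]
    rw [hcm]
    exact log_le_logTrunc N (norm_pos_iff.2 hθ)
  -- `‖q(e^{iθ₀})‖ ≤ 2^n M(q)`
  have hM : 0 < q.mahlerMeasure := mahlerMeasure_pos_of_ne_zero hq0
  have hev : ‖q.eval (cexp (θ₀ * I))‖ ≤ 2 ^ n * q.mahlerMeasure := by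
    refine (Literature.NumberTheory.Transcendental.Roy2013.norm_eval_le_two_pow_mul_mahlerMeasure q
      (by rw [Complex.norm_exp_ofReal_mul_I])).trans ?_
    exact mul_le_mul_of_nonneg_right (pow_le_pow_right₀ one_le_two hq) hM.le
  have hlogM : Real.log q.mahlerMeasure =
      (2 * π)⁻¹ * ∫ θ in (0)..(2 * π), Real.log ‖q.eval (circleMap 0 1 θ)‖ := by
    rw [mahlerMeasure_def_of_ne_zero hq0, Real.log_exp]
  have hpos : 0 < ‖q.eval (cexp (θ₀ * I))‖ := norm_pos_iff.2 h0
  have hlogev : Real.log ‖q.eval (cexp (θ₀ * I))‖ ≤ n * Real.log 2 + Real.log q.mahlerMeasure := by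
    calc Real.log ‖q.eval (cexp (θ₀ * I))‖ ≤ Real.log (2 ^ n * q.mahlerMeasure) :=
          Real.log_le_log hpos hev
      _ = n * Real.log 2 + Real.log q.mahlerMeasure := by
          rw [Real.log_mul (by positivity) hM.ne', Real.log_pow]
  have hmax := logTrunc_le_max N ‖q.eval (cexp (θ₀ * I))‖
  have hbr : max (Real.log ‖q.eval (cexp (θ₀ * I))‖) (-N) - n * Real.log 2 ≤ avg := by
    rw [sub_le_iff_le_add]
    refine max_le ?_ (by linarith)
    linarith [hlogM ▸ hdom]
  linarith

/-- **Monotone convergence for truncated logarithms.** If `f ≤ A` is measurable on a probability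
space and `L ≤ ∫ max f (-N)` for every `N ∈ ℕ`, then `f` is integrable and `L ≤ ∫ f`: the non-negative
functions `A - max f (-N)` increase to `A - f`, whose lower integral is therefore `≤ A - L`. [folklore] -/
theorem integrable_and_le_integral_of_le_integral_max {α : Type*} [MeasurableSpace α] (μ : Measure α)
    [IsProbabilityMeasure μ] {f : α → ℝ} (hf : Measurable f) {A L : ℝ} (hA0 : 0 ≤ A)
    (hA : ∀ x, f x ≤ A) (h : ∀ N : ℕ, L ≤ ∫ x, max (f x) (-(N : ℝ)) ∂μ) :
    Integrable f μ ∧ L ≤ ∫ x, f x ∂μ := by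
  have hmaxle : ∀ (N : ℕ) x, max (f x) (-(N : ℝ)) ≤ A := fun N x =>
    max_le (hA x) (by linarith [N.cast_nonneg (α := ℝ)])
  have hint : ∀ N : ℕ, Integrable (fun x => max (f x) (-(N : ℝ))) μ := fun N =>
    Integrable.of_bound (hf.max measurable_const).aestronglyMeasurable (max |(-(N : ℝ))| |A|)
      (Eventually.of_forall fun x => by
        rw [Real.norm_eq_abs]; exact abs_le_max_abs_abs (le_max_right _ _) (hmaxle N x))
  have hLA : L ≤ A := by
    refine (h 0).trans ?_
    calc ∫ x, max (f x) (-((0 : ℕ) : ℝ)) ∂μ ≤ ∫ _, A ∂μ :=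
          integral_mono (hint 0) (integrable_const A) fun x => hmaxle 0 x
      _ = A := by simp
  -- the increasing non-negative sequence `A - max f (-N)` with supremum `A - f`
  have hmono : Monotone fun (N : ℕ) x => ENNReal.ofReal (A - max (f x) (-(N : ℝ))) := by
    intro N M hNM x
    apply ENNReal.ofReal_le_ofReal
    have : (-(M : ℝ)) ≤ -(N : ℝ) := by exact_mod_cast neg_le_neg (Nat.cast_le.2 hNM)
    linarith [max_le_max (le_refl (f x)) this]
  have hsup : ∀ x, (⨆ N : ℕ, ENNReal.ofReal (A - max (f x) (-(N : ℝ)))) = ENNReal.ofReal (A - f x) := by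
    intro x
    apply le_antisymm
    · exact iSup_le fun N => ENNReal.ofReal_le_ofReal (by linarith [le_max_left (f x) (-(N : ℝ))])
    · obtain ⟨N, hN⟩ := exists_nat_ge (-f x)
      refine le_iSup_of_le N (le_of_eq ?_)
      rw [max_eq_left (by linarith)]
  have hle : ∀ N : ℕ, ∫⁻ x, ENNReal.ofReal (A - max (f x) (-(N : ℝ))) ∂μ ≤ ENNReal.ofReal (A - L) := by
    intro N
    rw [← ofReal_integral_eq_lintegral_ofReal ((integrable_const A).sub' (hint N))
      (Eventually.of_forall fun x => sub_nonneg.2 (hmaxle N x))]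
    apply ENNReal.ofReal_le_ofReal
    rw [integral_sub (integrable_const A) (hint N)]
    simp only [integral_const, probReal_univ, smul_eq_mul, one_mul]
    linarith [h N]
  have hfin : ∫⁻ x, ENNReal.ofReal (A - f x) ∂μ ≤ ENNReal.ofReal (A - L) := by
    calc ∫⁻ x, ENNReal.ofReal (A - f x) ∂μ
        = ∫⁻ x, ⨆ N : ℕ, ENNReal.ofReal (A - max (f x) (-(N : ℝ))) ∂μ := by simp_rw [hsup]
      _ = ⨆ N : ℕ, ∫⁻ x, ENNReal.ofReal (A - max (f x) (-(N : ℝ))) ∂μ :=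
          lintegral_iSup (fun N => (measurable_const.sub (hf.max measurable_const)).ennreal_ofReal)
            hmono
      _ ≤ ENNReal.ofReal (A - L) := iSup_le hle
  have hint2 : Integrable (fun x => A - f x) μ := by
    refine ⟨(measurable_const.sub hf).aestronglyMeasurable, ?_⟩
    rw [hasFiniteIntegral_iff_ofReal (Eventually.of_forall fun x => sub_nonneg.2 (hA x))]
    exact hfin.trans_lt ENNReal.ofReal_lt_top
  have hintf : Integrable f μ := by
    have hrw : f = fun x => A - (A - f x) := by ext; ring
    rw [hrw]
    exact (integrable_const A).sub' hint2
  have h3 : ∫ x, (A - f x) ∂μ ≤ A - L := by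
    rw [integral_eq_lintegral_of_nonneg_ae (Eventually.of_forall fun x => sub_nonneg.2 (hA x))
      hint2.aestronglyMeasurable]
    have := ENNReal.toReal_mono ENNReal.ofReal_ne_top hfin
    rwa [ENNReal.toReal_ofReal (sub_nonneg.2 hLA)] at this
  rw [integral_sub (integrable_const A) hintf] at h3
  simp only [integral_const, probReal_univ, smul_eq_mul, one_mul] at h3
  exact ⟨hintf, by linarith⟩

/-- **Monotone convergence for truncated logarithms** (inequality only). [folklore] -/
theorem le_integral_of_le_integral_max {α : Type*} [MeasurableSpace α] (μ : Measure α)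
    [IsProbabilityMeasure μ] {f : α → ℝ} (hf : Measurable f) {A L : ℝ} (hA0 : 0 ≤ A)
    (hA : ∀ x, f x ≤ A) (h : ∀ N : ℕ, L ≤ ∫ x, max (f x) (-(N : ℝ)) ∂μ) : L ≤ ∫ x, f x ∂μ :=
  (integrable_and_le_integral_of_le_integral_max μ hf hA0 hA h).2

end Summit.QuantumFields.QCD.Theorems.SingleLinkLogFlatness

end
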